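import Mathlib
import Summits.NavierStokesRegularity.NavierStokesRegularity.Theorems.TypeIIInviscidRelaxationColumnarCoreExclusionExplicitBudget
import Summits.NavierStokesRegularity.NavierStokesRegularity.Theorems.TypeIIInviscidRelaxationMonopoleCoreExclusionExplicitBudget
import HarnessLib

/-!
# Cruxes `ColumnarCoreExclusion` (stmt-1966) / `MonopoleCoreExclusion` (stmt-1965): the SHARP single-level residue
# — the dynamical statement restricted to the crux class (maximal smooth, not Type I), composed by name

`--supports stmt-NavierStokesRegularity-1966` (helper file; theorems only, no definitions, no `sorry`; the axisymmetric
half serves stmt-1965).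

The compositions of both comparison-flow lines apply their shadowing stub only to the crux's own solution `u`, which is
a MAXIMAL smooth solution with lifespan `T` (`IsMaximalSmoothSolution`) and NOT of Type I.  The explicit single-level
residues of `…{Columnar,Monopole}CoreExclusionExplicitBudget` (p840687 / p840704 / p840714 / p840715) quantify instead
over every classical solution on `[0,T)`.  This file records the weakest dynamical statement the compositions consume:

  `S_A(K)` := «for a maximal smooth solution `u` on `[0,T)` (Leray–Hopf, rapidly decaying datum, not Type I) with
  `‖u(t)‖ ≤ V`, a near-maximum within `L` of `x₀`, `Kν ≤ LV`, `(T - t)V ≤ KL`, and a bounded classical comparison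
  flow of the class (`A·V/K`-close to `u(t)` on the core ball), `u` is bounded on `[t,T) ×` inner ball»,
  with `A = 3` (columnar, balls `KL/2 ⊃ 3KL/8`) and `A = 2` (axisymmetric under `AX`, balls `KL ⊃ KL/2`),

i.e. «a Type II blow-up cannot carry, `K` core turnovers before its blow-up time, a `3V/K`-near-columnar (resp.
`2V/K`-near-axisymmetric) core around a point where it blows up».  For such `u` the horizon is automatically
super-viscous, `c⋆ν ≤ (T - t)V²` (`CoreExclusionShadowing.exists_viscousWindow_const`, p833576), so no viscous-window
case remains.

* `sharpShadowing_of_levelThreeShadowing`, `sharpAxisymShadowing_of_levelTwoShadowing` — `P_A(K) → S_A(K)` (drop the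
  two extra hypotheses): the sharp form is weaker than the explicit form, hence than the registered stubs.
* `columnarCoreExclusion_of_sharpLevelPair`, `monopoleCoreExclusion_of_sharpLevelPair` — KERNEL COMPOSITIONS: ONE
  level `K ≥ 1` with `S_A(K)` and the anchor statement at level `K` gives the crux BY NAME.  With
  `…ShadowingSmallLevel` (p840728) the level may be taken `> 2A` without loss.

Honest framing.  The final consolidation of this hand's bookkeeping: the pair (`S_3(K)`, `Anchor(K)`) for one `K > 6`
(resp. (`S₂(K)`, `Anchor(K)`) for one `K > 4`, under `AX`) is the exact typed research residue of the two lines, ready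
to be registered verbatim by a line-writer; its two halves are the open content ([XL] dynamics / [L] lateness).  No stub
is closed by name; nothing about Navier–Stokes regularity is claimed; rung 0.
-/

noncomputable section

open Set Metric
open Literature.Analysis Literature.Analysis.FluidPDE

namespace Summit.NavierStokesRegularity.NavierStokesRegularity.Theorems

-- the problem directory repeats the summit name (`NavierStokesRegularity/NavierStokesRegularity`)
set_option linter.dupNamespace false

namespace CoreExclusionShadowing

/-! ## Columnar class (stmt-1966) -/

/-- **Sharp single-level composition, columnar class.**  ONE level `K ≥ 1` carrying the SHARP shadowing statement
`S_3(K)` (maximal smooth, not Type I, Leray–Hopf, decaying datum; core normalisation; `Kν ≤ LV`; `(T - t)V ≤ KL`;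
bounded exactly columnar classical flow `3V/K`-close on `B(x₀, KL/2)` ⟹ bounded on `[t,T) × B(x₀, 3KL/8)`) together
with the anchor statement at level `K` gives `ColumnarCoreExclusion` BY NAME (comparison flow
`ColumnarComparisonFlow.columnarComparisonFlow_three`; `ρ = min (KL/8) √(T - t)`). [folklore] -/
theorem columnarCoreExclusion_of_sharpLevelPair
    (h : ∃ K : ℝ, 1 ≤ K ∧
      (∀ (ν T t : ℝ) (u : ℝ → EuclideanSpace ℝ (Fin 3) → EuclideanSpace ℝ (Fin 3))
        (p : ℝ → EuclideanSpace ℝ (Fin 3) → ℝ),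
        0 < ν → 0 < T → IsMaximalSmoothSolution ν 0 u p T → IsLerayHopfOn T ν 0 (u 0) u →
        HasRapidSpatialDecay (u 0) → ¬ IsTypeIBlowup u T → 0 < t → t < T →
        ∀ (x₀ : EuclideanSpace ℝ (Fin 3)) (L V : ℝ)
          (Q : EuclideanSpace ℝ (Fin 3) ≃ₗᵢ[ℝ] EuclideanSpace ℝ (Fin 3)),
          0 < L → 0 < V → (∀ x, ‖u t x‖ ≤ V) →
          (∃ x₁, dist x₁ x₀ ≤ L ∧ V ≤ 2 * ‖u t x₁‖) → K * ν ≤ L * V → (T - t) * V ≤ K * L →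
          ∀ (v : ℝ → EuclideanSpace ℝ (Fin 3) → EuclideanSpace ℝ (Fin 3))
            (q : ℝ → EuclideanSpace ℝ (Fin 3) → ℝ) (Mv : ℝ),
            IsClassicalNSSolutionOn (Icc t T) ν 0 v q →
            (∀ s ∈ Icc t T, ∀ (x : EuclideanSpace ℝ (Fin 3)) (τ : ℝ), v s (x + τ • Q eZ) = v s x) →
            (∀ s ∈ Icc t T, ∀ x, ‖v s x‖ ≤ Mv) →
            (∀ x ∈ ball x₀ (K * L / 2), ‖u t x - v t x‖ ≤ 3 * V / K) →
            ∃ M : ℝ, ∀ s ∈ Ico t T, ∀ x ∈ ball x₀ (3 * K * L / 8), ‖u s x‖ ≤ M) ∧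
      (∀ (ν T : ℝ) (u : ℝ → EuclideanSpace ℝ (Fin 3) → EuclideanSpace ℝ (Fin 3))
        (p : ℝ → EuclideanSpace ℝ (Fin 3) → ℝ),
        0 < ν → 0 < T → IsMaximalSmoothSolution ν 0 u p T → IsLerayHopfOn T ν 0 (u 0) u →
        HasRapidSpatialDecay (u 0) → ¬ IsTypeIBlowup u T →
        (∀ K' : ℝ, 0 < K' → ∀ t₀ < T, ∃ t, t₀ < t ∧ t < T ∧ TypeIICoreWitness IsColumnar ν K' u t) →
        ∃ xs : EuclideanSpace ℝ (Fin 3),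
          (¬ ∃ ρ M : ℝ, 0 < ρ ∧ ∀ s ∈ Ioo (T - ρ ^ 2) T, ∀ x ∈ ball xs ρ, ‖u s x‖ ≤ M) ∧
          ∃ t : ℝ, 0 < t ∧ t < T ∧
            ∃ (x₀ : EuclideanSpace ℝ (Fin 3)) (L V : ℝ)
              (Q : EuclideanSpace ℝ (Fin 3) ≃ₗᵢ[ℝ] EuclideanSpace ℝ (Fin 3))
              (W : EuclideanSpace ℝ (Fin 3) → EuclideanSpace ℝ (Fin 3)),
              0 < L ∧ 0 < V ∧ IsColumnar W ∧ (∀ x, ‖u t x‖ ≤ V) ∧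
              (∃ x₁, dist x₁ x₀ ≤ L ∧ V ≤ 2 * ‖u t x₁‖) ∧
              (∃ y y' : EuclideanSpace ℝ (Fin 3), ‖y‖ ≤ 1 ∧ ‖y'‖ ≤ 1 ∧ (4 : ℝ)⁻¹ ≤ ‖W y - W y'‖) ∧
              K * ν ≤ L * V ∧
              (∀ y : EuclideanSpace ℝ (Fin 3), ‖y‖ ≤ K →
                ‖V⁻¹ • Q.symm (u t (x₀ + L • Q y)) - W y‖ ≤ K⁻¹) ∧
              (T - t) * V ≤ K * L ∧ dist xs x₀ ≤ K * L / 4)) :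
    Summit.NavierStokesRegularity.NavierStokesRegularity.Theses.TypeIIInviscidRelaxation.ColumnarCoreExclusion := by
  intro ν T hν hT u p hmax hLH hdec hnI hw
  obtain ⟨K₀, hK₀1, hstab, hanchor⟩ := h
  obtain ⟨xs, hsing, t, ht0, htT, x₀, L, V, Q, W, hL, hV, hcol, hbd, hnear, _hosc, hRe, hclose, hlate, hdist⟩ :=
    hanchor ν T u p hν hT hmax hLH hdec hnI hw
  obtain ⟨v, q, Mv, hv, hvcol, hvbd, hvclose⟩ :=
    ColumnarComparisonFlow.columnarComparisonFlow_three ν T t K₀ u p hν hT hmax.1 hLH hdec ht0 htT hK₀1 x₀ L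
      V Q W hL hV hcol hbd hRe hclose
  obtain ⟨M, hM⟩ := hstab ν T t u p hν hT hmax hLH hdec hnI ht0 htT x₀ L V Q hL hV hbd hnear hRe hlate v q
    Mv hv hvcol hvbd hvclose
  apply hsing
  have hK₀ : 0 < K₀ := lt_of_lt_of_le one_pos hK₀1
  have hTt : 0 < T - t := sub_pos.2 htT
  set ρ : ℝ := min (K₀ * L / 8) (Real.sqrt (T - t)) with hρ
  have hρpos : 0 < ρ := lt_min (by positivity) (Real.sqrt_pos.2 hTt)
  have hρsq : ρ ^ 2 ≤ T - t :=
    calc ρ ^ 2 ≤ (Real.sqrt (T - t)) ^ 2 := pow_le_pow_left₀ hρpos.le (min_le_right _ _) 2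
      _ = T - t := Real.sq_sqrt hTt.le
  have hρle : ρ ≤ K₀ * L / 8 := min_le_left _ _
  refine ⟨ρ, M, hρpos, fun s hs x hx => hM s ⟨?_, hs.2⟩ x ?_⟩
  · linarith [hs.1]
  · rw [mem_ball] at hx ⊢
    calc dist x x₀ ≤ dist x xs + dist xs x₀ := dist_triangle _ _ _
      _ < ρ + K₀ * L / 4 := by linarith
      _ ≤ K₀ * L / 8 + K₀ * L / 4 := by linarith
      _ = 3 * K₀ * L / 8 := by ring

/-- **The explicit form implies the sharp form, columnar class.**  `P_3(K) → S_3(K)`: forget `¬ IsTypeIBlowup` and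
keep only the classical part of `IsMaximalSmoothSolution`. [folklore] -/
theorem sharpShadowing_of_levelThreeShadowing {K : ℝ}
    (hP : ∀ (ν T t : ℝ) (u : ℝ → EuclideanSpace ℝ (Fin 3) → EuclideanSpace ℝ (Fin 3))
        (p : ℝ → EuclideanSpace ℝ (Fin 3) → ℝ),
        0 < ν → 0 < T → IsClassicalNSSolutionOn (Ico 0 T) ν 0 u p → IsLerayHopfOn T ν 0 (u 0) u →
        HasRapidSpatialDecay (u 0) → 0 < t → t < T →
        ∀ (x₀ : EuclideanSpace ℝ (Fin 3)) (L V : ℝ)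
          (Q : EuclideanSpace ℝ (Fin 3) ≃ₗᵢ[ℝ] EuclideanSpace ℝ (Fin 3)),
          0 < L → 0 < V → (∀ x, ‖u t x‖ ≤ V) →
          (∃ x₁, dist x₁ x₀ ≤ L ∧ V ≤ 2 * ‖u t x₁‖) → K * ν ≤ L * V → (T - t) * V ≤ K * L →
          ∀ (v : ℝ → EuclideanSpace ℝ (Fin 3) → EuclideanSpace ℝ (Fin 3))
            (q : ℝ → EuclideanSpace ℝ (Fin 3) → ℝ) (Mv : ℝ),
            IsClassicalNSSolutionOn (Icc t T) ν 0 v q →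
            (∀ s ∈ Icc t T, ∀ (x : EuclideanSpace ℝ (Fin 3)) (τ : ℝ), v s (x + τ • Q eZ) = v s x) →
            (∀ s ∈ Icc t T, ∀ x, ‖v s x‖ ≤ Mv) →
            (∀ x ∈ ball x₀ (K * L / 2), ‖u t x - v t x‖ ≤ 3 * V / K) →
            ∃ M : ℝ, ∀ s ∈ Ico t T, ∀ x ∈ ball x₀ (3 * K * L / 8), ‖u s x‖ ≤ M) :
    ∀ (ν T t : ℝ) (u : ℝ → EuclideanSpace ℝ (Fin 3) → EuclideanSpace ℝ (Fin 3))
      (p : ℝ → EuclideanSpace ℝ (Fin 3) → ℝ),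
      0 < ν → 0 < T → IsMaximalSmoothSolution ν 0 u p T → IsLerayHopfOn T ν 0 (u 0) u →
      HasRapidSpatialDecay (u 0) → ¬ IsTypeIBlowup u T → 0 < t → t < T →
      ∀ (x₀ : EuclideanSpace ℝ (Fin 3)) (L V : ℝ)
        (Q : EuclideanSpace ℝ (Fin 3) ≃ₗᵢ[ℝ] EuclideanSpace ℝ (Fin 3)),
        0 < L → 0 < V → (∀ x, ‖u t x‖ ≤ V) →
        (∃ x₁, dist x₁ x₀ ≤ L ∧ V ≤ 2 * ‖u t x₁‖) → K * ν ≤ L * V → (T - t) * V ≤ K * L →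
        ∀ (v : ℝ → EuclideanSpace ℝ (Fin 3) → EuclideanSpace ℝ (Fin 3))
          (q : ℝ → EuclideanSpace ℝ (Fin 3) → ℝ) (Mv : ℝ),
          IsClassicalNSSolutionOn (Icc t T) ν 0 v q →
          (∀ s ∈ Icc t T, ∀ (x : EuclideanSpace ℝ (Fin 3)) (τ : ℝ), v s (x + τ • Q eZ) = v s x) →
          (∀ s ∈ Icc t T, ∀ x, ‖v s x‖ ≤ Mv) →
          (∀ x ∈ ball x₀ (K * L / 2), ‖u t x - v t x‖ ≤ 3 * V / K) →
          ∃ M : ℝ, ∀ s ∈ Ico t T, ∀ x ∈ ball x₀ (3 * K * L / 8), ‖u s x‖ ≤ M :=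
  fun ν T t u p hν hT hmax hLH hdec _ ht htT x₀ L V Q hL hV hbd hnear hRe hlate v q Mv hv hvcol hvbd hclose =>
    hP ν T t u p hν hT hmax.1 hLH hdec ht htT x₀ L V Q hL hV hbd hnear hRe hlate v q Mv hv hvcol hvbd hclose

/-! ## Axisymmetric class (stmt-1965) -/

/-- **Sharp single-level composition, axisymmetric class.**  ONE level `K ≥ 1` carrying the SHARP axisymmetric
shadowing statement `S₂(K)` (maximal smooth, not Type I, Leray–Hopf, decaying datum; core normalisation; `Kν ≤ LV`;
`(T - t)V ≤ KL`; bounded classical flow exactly axisymmetric about `x₀ + ℝ·Q e_z`, `2V/K`-close on `B(x₀, KL)` ⟹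
bounded on `[t,T) × B(x₀, KL/2)`) together with the anchor statement at level `K` gives `MonopoleCoreExclusion` BY
NAME (its antecedent `AxisymSwirlRegular` feeds `AxisymComparisonFlow.axisymComparisonFlowOfAX_two`;
`ρ = min (KL/4) √(T - t)`). [folklore] -/
theorem monopoleCoreExclusion_of_sharpLevelPair
    (h : ∃ K : ℝ, 1 ≤ K ∧
      (∀ (ν T t : ℝ) (u : ℝ → EuclideanSpace ℝ (Fin 3) → EuclideanSpace ℝ (Fin 3))
        (p : ℝ → EuclideanSpace ℝ (Fin 3) → ℝ),
        0 < ν → 0 < T → IsMaximalSmoothSolution ν 0 u p T → IsLerayHopfOn T ν 0 (u 0) u →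
        HasRapidSpatialDecay (u 0) → ¬ IsTypeIBlowup u T → 0 < t → t < T →
        ∀ (x₀ : EuclideanSpace ℝ (Fin 3)) (L V : ℝ)
          (Q : EuclideanSpace ℝ (Fin 3) ≃ₗᵢ[ℝ] EuclideanSpace ℝ (Fin 3)),
          0 < L → 0 < V → (∀ x, ‖u t x‖ ≤ V) →
          (∃ x₁, dist x₁ x₀ ≤ L ∧ V ≤ 2 * ‖u t x₁‖) → K * ν ≤ L * V → (T - t) * V ≤ K * L →
          ∀ (v : ℝ → EuclideanSpace ℝ (Fin 3) → EuclideanSpace ℝ (Fin 3))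
            (q : ℝ → EuclideanSpace ℝ (Fin 3) → ℝ) (Mv : ℝ),
            IsClassicalNSSolutionOn (Icc t T) ν 0 v q →
            (∀ s ∈ Icc t T, IsAxisymmetric (fun y : EuclideanSpace ℝ (Fin 3) => Q.symm (v s (x₀ + Q y)))) →
            (∀ s ∈ Icc t T, ∀ x, ‖v s x‖ ≤ Mv) →
            (∀ x ∈ ball x₀ (K * L), ‖u t x - v t x‖ ≤ 2 * V / K) →
            ∃ M : ℝ, ∀ s ∈ Ico t T, ∀ x ∈ ball x₀ (K * L / 2), ‖u s x‖ ≤ M) ∧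
      (∀ (ν T : ℝ) (u : ℝ → EuclideanSpace ℝ (Fin 3) → EuclideanSpace ℝ (Fin 3))
        (p : ℝ → EuclideanSpace ℝ (Fin 3) → ℝ),
        0 < ν → 0 < T → IsMaximalSmoothSolution ν 0 u p T → IsLerayHopfOn T ν 0 (u 0) u →
        HasRapidSpatialDecay (u 0) → ¬ IsTypeIBlowup u T →
        (∀ K' : ℝ, 0 < K' → ∀ t₀ < T, ∃ t, t₀ < t ∧ t < T ∧ TypeIICoreWitness IsAxisymmetric ν K' u t) →
        ∃ xs : EuclideanSpace ℝ (Fin 3),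
          (¬ ∃ ρ M : ℝ, 0 < ρ ∧ ∀ s ∈ Ioo (T - ρ ^ 2) T, ∀ x ∈ ball xs ρ, ‖u s x‖ ≤ M) ∧
          ∃ t : ℝ, 0 < t ∧ t < T ∧
            ∃ (x₀ : EuclideanSpace ℝ (Fin 3)) (L V : ℝ)
              (Q : EuclideanSpace ℝ (Fin 3) ≃ₗᵢ[ℝ] EuclideanSpace ℝ (Fin 3))
              (W : EuclideanSpace ℝ (Fin 3) → EuclideanSpace ℝ (Fin 3)),
              0 < L ∧ 0 < V ∧ IsAxisymmetric W ∧ (∀ x, ‖u t x‖ ≤ V) ∧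
              (∃ x₁, dist x₁ x₀ ≤ L ∧ V ≤ 2 * ‖u t x₁‖) ∧
              (∃ y y' : EuclideanSpace ℝ (Fin 3), ‖y‖ ≤ 1 ∧ ‖y'‖ ≤ 1 ∧ (4 : ℝ)⁻¹ ≤ ‖W y - W y'‖) ∧
              K * ν ≤ L * V ∧
              (∀ y : EuclideanSpace ℝ (Fin 3), ‖y‖ ≤ K →
                ‖V⁻¹ • Q.symm (u t (x₀ + L • Q y)) - W y‖ ≤ K⁻¹) ∧
              (T - t) * V ≤ K * L ∧ dist xs x₀ ≤ K * L / 4)) :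
    Summit.NavierStokesRegularity.NavierStokesRegularity.Theses.TypeIIInviscidRelaxation.MonopoleCoreExclusion := by
  intro hAX ν T hν hT u p hmax hLH hdec hnI hw
  obtain ⟨K₀, hK₀1, hstab, hanchor⟩ := h
  obtain ⟨xs, hsing, t, ht0, htT, x₀, L, V, Q, W, hL, hV, hax, hbd, hnear, _hosc, hRe, hclose, hlate, hdist⟩ :=
    hanchor ν T u p hν hT hmax hLH hdec hnI hw
  obtain ⟨v, q, Mv, hv, hvax, hvbd, hvclose⟩ :=
    AxisymComparisonFlow.axisymComparisonFlowOfAX_two hAX ν T t K₀ u p hν hT hmax.1 hLH hdec ht0 htT hK₀1 x₀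
      L V Q W hL hV hax hbd hRe hclose
  obtain ⟨M, hM⟩ := hstab ν T t u p hν hT hmax hLH hdec hnI ht0 htT x₀ L V Q hL hV hbd hnear hRe hlate v q
    Mv hv hvax hvbd hvclose
  apply hsing
  have hK₀ : 0 < K₀ := lt_of_lt_of_le one_pos hK₀1
  have hTt : 0 < T - t := sub_pos.2 htT
  set ρ : ℝ := min (K₀ * L / 4) (Real.sqrt (T - t)) with hρ
  have hρpos : 0 < ρ := lt_min (by positivity) (Real.sqrt_pos.2 hTt)
  have hρsq : ρ ^ 2 ≤ T - t :=
    calc ρ ^ 2 ≤ (Real.sqrt (T - t)) ^ 2 := pow_le_pow_left₀ hρpos.le (min_le_right _ _) 2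
      _ = T - t := Real.sq_sqrt hTt.le
  have hρle : ρ ≤ K₀ * L / 4 := min_le_left _ _
  refine ⟨ρ, M, hρpos, fun s hs x hx => hM s ⟨?_, hs.2⟩ x ?_⟩
  · linarith [hs.1]
  · rw [mem_ball] at hx ⊢
    calc dist x x₀ ≤ dist x xs + dist xs x₀ := dist_triangle _ _ _
      _ < ρ + K₀ * L / 4 := by linarith
      _ ≤ K₀ * L / 4 + K₀ * L / 4 := by linarith
      _ = K₀ * L / 2 := by ring

/-- **The explicit form implies the sharp form, axisymmetric class.**  `P₂(K) → S₂(K)`. [folklore] -/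
theorem sharpAxisymShadowing_of_levelTwoShadowing {K : ℝ}
    (hP : ∀ (ν T t : ℝ) (u : ℝ → EuclideanSpace ℝ (Fin 3) → EuclideanSpace ℝ (Fin 3))
        (p : ℝ → EuclideanSpace ℝ (Fin 3) → ℝ),
        0 < ν → 0 < T → IsClassicalNSSolutionOn (Ico 0 T) ν 0 u p → IsLerayHopfOn T ν 0 (u 0) u →
        HasRapidSpatialDecay (u 0) → 0 < t → t < T →
        ∀ (x₀ : EuclideanSpace ℝ (Fin 3)) (L V : ℝ)
          (Q : EuclideanSpace ℝ (Fin 3) ≃ₗᵢ[ℝ] EuclideanSpace ℝ (Fin 3)),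
          0 < L → 0 < V → (∀ x, ‖u t x‖ ≤ V) →
          (∃ x₁, dist x₁ x₀ ≤ L ∧ V ≤ 2 * ‖u t x₁‖) → K * ν ≤ L * V → (T - t) * V ≤ K * L →
          ∀ (v : ℝ → EuclideanSpace ℝ (Fin 3) → EuclideanSpace ℝ (Fin 3))
            (q : ℝ → EuclideanSpace ℝ (Fin 3) → ℝ) (Mv : ℝ),
            IsClassicalNSSolutionOn (Icc t T) ν 0 v q →
            (∀ s ∈ Icc t T, IsAxisymmetric (fun y : EuclideanSpace ℝ (Fin 3) => Q.symm (v s (x₀ + Q y)))) →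
            (∀ s ∈ Icc t T, ∀ x, ‖v s x‖ ≤ Mv) →
            (∀ x ∈ ball x₀ (K * L), ‖u t x - v t x‖ ≤ 2 * V / K) →
            ∃ M : ℝ, ∀ s ∈ Ico t T, ∀ x ∈ ball x₀ (K * L / 2), ‖u s x‖ ≤ M) :
    ∀ (ν T t : ℝ) (u : ℝ → EuclideanSpace ℝ (Fin 3) → EuclideanSpace ℝ (Fin 3))
      (p : ℝ → EuclideanSpace ℝ (Fin 3) → ℝ),
      0 < ν → 0 < T → IsMaximalSmoothSolution ν 0 u p T → IsLerayHopfOn T ν 0 (u 0) u →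
      HasRapidSpatialDecay (u 0) → ¬ IsTypeIBlowup u T → 0 < t → t < T →
      ∀ (x₀ : EuclideanSpace ℝ (Fin 3)) (L V : ℝ)
        (Q : EuclideanSpace ℝ (Fin 3) ≃ₗᵢ[ℝ] EuclideanSpace ℝ (Fin 3)),
        0 < L → 0 < V → (∀ x, ‖u t x‖ ≤ V) →
        (∃ x₁, dist x₁ x₀ ≤ L ∧ V ≤ 2 * ‖u t x₁‖) → K * ν ≤ L * V → (T - t) * V ≤ K * L →
        ∀ (v : ℝ → EuclideanSpace ℝ (Fin 3) → EuclideanSpace ℝ (Fin 3))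
          (q : ℝ → EuclideanSpace ℝ (Fin 3) → ℝ) (Mv : ℝ),
          IsClassicalNSSolutionOn (Icc t T) ν 0 v q →
          (∀ s ∈ Icc t T, IsAxisymmetric (fun y : EuclideanSpace ℝ (Fin 3) => Q.symm (v s (x₀ + Q y)))) →
          (∀ s ∈ Icc t T, ∀ x, ‖v s x‖ ≤ Mv) →
          (∀ x ∈ ball x₀ (K * L), ‖u t x - v t x‖ ≤ 2 * V / K) →
          ∃ M : ℝ, ∀ s ∈ Ico t T, ∀ x ∈ ball x₀ (K * L / 2), ‖u s x‖ ≤ M :=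
  fun ν T t u p hν hT hmax hLH hdec _ ht htT x₀ L V Q hL hV hbd hnear hRe hlate v q Mv hv hvax hvbd hclose =>
    hP ν T t u p hν hT hmax.1 hLH hdec ht htT x₀ L V Q hL hV hbd hnear hRe hlate v q Mv hv hvax hvbd hclose

end CoreExclusionShadowing

end Summit.NavierStokesRegularity.NavierStokesRegularity.Theorems

end
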